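import Summits.QuantumFields.BalabanUV.T4Continuum.Support.SubstrateSlotsOfRecordShift
import Summits.QuantumFields.BalabanUV.T4Continuum.Support.B13StepOfRecord

/-!
# SUBSTRATE — THE ZERO-TERMS CONVENTION IS A χ-LETTER (W-23b = LIBRARY L-E17b; typer ruling (ο6)): a factor whose χ-constraint list
# contains a SMALL-field window `(b, thr, true)` with NON-POSITIVE threshold `thr ≤ 0` (canonically the empty window `((0 : V →L[ℝ] ℝ), 0,
# true)`) has `chiSet = ∅`, hence `termAt = 0`, hence `Slots.act Z ℓ = 0` at the slots of record, hence every (2.13)-term with such a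
# factor vanishes — answer (c) to row NE1′'s Q-NE1p-emb ([dict] layer of the cell's brief, NE1′ F-2 junction)

Cell `pub-balaban`, SUBSTRATE cell, seat `b2b-balaban-substrate-p1` (gen 6).  Summits-side under the LEAN PLACEMENT RULE (cell bookkeeping).
HONEST FRAMING: rung (B)+1 of the FINITE-VOLUME T⁴ programme — NOT infinite volume, NOT a mass gap, NOT Clay; spine PROVED 0∕9; NE1′ ∕ NE5
NOT PRINTED ∕ NOT PROVED.  HONEST DEPENDENCY (cell line, verbatim): continuum YM on T⁴ ⇐ BetaPertH ∧ nine spine estimates (0/9 proved);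
BetaPertH ⇐ (D1) ∧ (D4) ∧ CAP+tail; G-an2-4 gates asym, D1 and NE2/3/4.

THE QUESTION (row NE1′ owner, Q-NE1p-emb, journal l.18210 ∕ re-asked l.21599; cell answer of record l.21854, typer (ο6) l.22023): «does the
substrate's `Slots.act Z ℓ` VANISH off print's finer label filter (p. 12 `P ⊂ Y₀^{c*}`, p. 18 `|P| ≥ ½M⁻⁴|Z₀∖Y₀|`; row NE5 d1's convention,
`B13StepTermLabels.InnerLabel.WF` docstring: «the finer printed constraints … are left to the term definition (zero terms)»)?»  ANSWER, in
the kernel: NOT BY CONSTRUCTION — `SubstrateSlotsOfRecord.slotsOfRecord_act` is `SubstrateActivities.actOfLetters (coreLettersOf L.A)`, ONE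
Gaussian contour integral `(coreOf … Z ℓ).termAt o h` for EVERY pair `(Z, ℓ)` (the tree's only catalogue-level vanishing is
`B13StepTermFamily.term_of_not_rel`, off well-formedness) — BUT the convention IS a DISPLAYED LETTER of the calibration table
`L.A : ∀ Z ℓ, ActLetters …` (row NE5's identification of [Balaban1988RG2Cluster] (2.14), not the substrate's to choose): by
`B13TermParamGaussianBi.BiCore.chi = chiSet.indicator ((−1)^nsign)`, `chiSet = {v | ∀ c ∈ cons, v ∈ consSet c}` and `consSet (b, thr, true)
= {v | |b v| < thr}`, a small-field window `(b, thr, true)` with `thr ≤ 0` — in particular the EMPTY window `((0 : V →L[ℝ] ℝ), 0, true)` —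
empties `chiSet` (`0 ≤ |b v|`), so `termAt = ∫ w·N·(∫ chi·e^{readOut}·e^{−q}) = 0`.

WHAT (theorems only, 0 def — PROOF lane; nothing existing is modified; everything in THIS file's namespace, row NE5's namespaces untouched;
imports W-21 `SubstrateSlotsOfRecordShift` (p234583, hence O-8 `SubstrateSlotsOfRecord` p220104 and `SubstrateActivities` p219669) and row
NE5's `B13StepOfRecord` (p208933) ONLY):
* §1 (generic `BiCore`, the kill letter at its natural generality — typer rider (β)): `consSet_small_eq_empty_of_nonpos` (`thr ≤ 0 →
  consSet (b, thr, true) = ∅`), **`chiSet_eq_empty_of_mem_cons`** (`(b, thr, true) ∈ 𝔠.cons → thr ≤ 0 → 𝔠.chiSet = ∅`),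
  `chi_eq_zero_of_chiSet_eq_empty`, **`termAt_eq_zero_of_chiSet_eq_empty`**, **`termAt_eq_zero_of_mem_cons`**; the empty window
  `((0 : V →L[ℝ] ℝ), 0, true)` as corollaries `chiSet_eq_empty_of_zero_window_mem` ∕ `termAt_eq_zero_of_zero_window_mem`.
* §2 (the substrate's letters): **`actOfLetters_eq_zero_of_mem_cons`** (`(b, thr, true) ∈ (ℓ Z j).cons → thr ≤ 0 → actOfLetters … ℓ Z j o h
  = 0`, all `o h`), `coreLettersOf_cons` (rfl), **`slotsOfRecord_act_eq_zero_of_mem_cons`** (`(b, thr, true) ∈ (L.A Z ℓ).cons → thr ≤ 0 →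
  (slotsOfRecord …).act Z ℓ o h = 0`), the same at the cov-shifted slots `slotsOfRecordShift_act_eq_zero_of_mem_cons` (W-21's `act` is
  `slotsOfRecord`'s, `rfl`), the empty-window corollary `slotsOfRecord_act_eq_zero_of_zero_window_mem`, and the packaged pruning
  **`sum_slotsOfRecord_act_eq_sum_filter`**: if every label of `S` OFF a decidable filter `fine` is KILLED by the calibration
  (`∃ b thr, thr ≤ 0 ∧ (b, thr, true) ∈ (L.A Z ℓ).cons`), then `Σ_{ℓ ∈ S} act Z ℓ = Σ_{ℓ ∈ S.filter fine} act Z ℓ` (`Finset.sum_filter_of_ne`).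
* §3 (term level, generic over leaf-08's `TermIndexing`): `term_eq_zero_of_factor_eq_zero` (one vanishing factor activity zeroes the (2.13)-term:
  `term_of_rel` + `Finset.prod_eq_zero`), and on the carriers of record **`term_slotsOfRecord_eq_zero_of_mem_cons`**: a term label `t` one of
  whose factors `t.2 m` is killed at its polymer contributes `0` to `(step (slotsOfRecord …) E₀ cB).Out` (`B13StepOfRecord.step_Out`).
So «off the filter the substrate's terms vanish» is the LETTER CONDITION `hkill : ∀ ℓ ∈ innerLabels (b13InnerData R) k Z, ¬ fine Z ℓ → ∃ b thr,
thr ≤ 0 ∧ (b, thr, true) ∈ (L.A Z ℓ).cons` on row NE5's calibration, discharged to `act = 0` ∕ `term = 0` BY NAME here.  HONEST: bookkeeping;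
WHICH labels a calibration kills is row NE5's displayed identification of (2.14); nothing of (B1b)∕(B3) or of any estimate is discharged; 0 sorry.
-/

noncomputable section

open scoped BigOperators
open MeasureTheory

namespace Summit.QuantumFields.BalabanUV.T4Continuum.SubstrateSlotActZero

open Literature.MathematicalPhysics.QuantumFieldTheory.Balaban1983to89
open Literature.MathematicalPhysics.QuantumFieldTheory.Balaban1983to89.T4OutputRate (Carriers)
open Summit.QuantumFields.BalabanUV.T4Continuum.B13HistMeasurable (MeasPotFrame B13HistM)
open Summit.QuantumFields.BalabanUV.T4Continuum.B13TermParamGaussianBi (BiCore)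
open Summit.QuantumFields.BalabanUV.T4Continuum.B13TermParamGaussianBi.BiCore (consSet)
open Summit.QuantumFields.BalabanUV.T4Continuum.B13OpDatum (OpDatum)
open Summit.QuantumFields.BalabanUV.T4Continuum.B13StepTermLabels (InnerLabel TermIdx)
open Summit.QuantumFields.BalabanUV.T4Continuum.B13StepTermFamily (TermIndexing term term_of_rel term_of_not_rel)
open Summit.QuantumFields.BalabanUV.T4Continuum.B13StepTermSocket (labelsIndexing touchInc)
open Summit.QuantumFields.BalabanUV.T4Continuum.B13InnerData (Bnd b13InnerData)
open Summit.QuantumFields.BalabanUV.T4Continuum.B13StepOfRecord (Slots step step_Out)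
open Summit.QuantumFields.BalabanUV.T4Continuum.SubstrateTwoRunsDriven (DrivenRuns)
open Summit.QuantumFields.BalabanUV.T4Continuum.SubstrateActivities (CoreLetters coreOf actOfLetters actOfLetters_apply coreOf_cons)
open Summit.QuantumFields.BalabanUV.T4Continuum.SubstrateSlotsOfRecord
open Summit.QuantumFields.BalabanUV.T4Continuum.SubstrateSlotsOfRecordShift (slotsOfRecordShift slotsOfRecordShift_act)

/-! ## §1 The kill letter on a generic (2.14)-core: a small-field window with non-positive threshold -/

section Core

variable {C : Carriers} {P : MeasPotFrame C} {𝒴 : Type*} {dom : 𝒴 → C.Dom} {Op PΛ V : Type*} [MeasurableSpace PΛ]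
  [NormedAddCommGroup V] [InnerProductSpace ℝ V] [MeasurableSpace V]

omit [MeasurableSpace V] in
/-- [folklore] A SMALL-field window `|b v| < thr` with `thr ≤ 0` cuts out the empty set (`0 ≤ |b v|`). -/
theorem consSet_small_eq_empty_of_nonpos (b : V →L[ℝ] ℝ) {thr : ℝ} (hthr : thr ≤ 0) : consSet (b, thr, true) = (∅ : Set V) := by
  ext v
  simp only [consSet, cond_true, Set.mem_setOf_eq, Set.mem_empty_iff_false, iff_false, not_lt]
  exact hthr.trans (abs_nonneg _)

/-- [folklore] **THE KILL LETTER**: a core whose χ-list contains a small-field window `(b, thr, true)` with `thr ≤ 0` has EMPTY constraint set. -/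
theorem chiSet_eq_empty_of_mem_cons (𝔠 : BiCore P dom Op PΛ V) {b : V →L[ℝ] ℝ} {thr : ℝ} (hc : (b, thr, true) ∈ 𝔠.cons)
    (hthr : thr ≤ 0) : 𝔠.chiSet = ∅ := by
  ext v
  simp only [BiCore.chiSet, Set.mem_setOf_eq, Set.mem_empty_iff_false, iff_false, not_forall]
  exact ⟨(b, thr, true), hc, by rw [consSet_small_eq_empty_of_nonpos b hthr]; exact Set.notMem_empty v⟩

/-- [folklore] The EMPTY window `((0 : V →L[ℝ] ℝ), 0, true)` (the zero read-out constrained small with threshold `0`) kills. -/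
theorem chiSet_eq_empty_of_zero_window_mem (𝔠 : BiCore P dom Op PΛ V) (hc : ((0 : V →L[ℝ] ℝ), (0 : ℝ), true) ∈ 𝔠.cons) :
    𝔠.chiSet = ∅ :=
  chiSet_eq_empty_of_mem_cons 𝔠 hc le_rfl

/-- [folklore] Empty constraint set ⇒ the potential-free factor vanishes identically. -/
theorem chi_eq_zero_of_chiSet_eq_empty (𝔠 : BiCore P dom Op PΛ V) (h : 𝔠.chiSet = ∅) (v : V) : 𝔠.chi v = 0 := by
  simp [BiCore.chi, h]

variable [BorelSpace V] [FiniteDimensional ℝ V]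

/-- [folklore] **EMPTY CONSTRAINT SET ⇒ THE TERM OF THE CORE VANISHES** at every operator datum and table: the inner Gaussian integrand
`chi·e^{readOut}·e^{−q}` is identically `0`. -/
theorem termAt_eq_zero_of_chiSet_eq_empty (𝔠 : BiCore P dom Op PΛ V) (h : 𝔠.chiSet = ∅) (o : Op) (y : B13HistM P) :
    𝔠.termAt o y = 0 := by
  unfold BiCore.termAt
  simp [chi_eq_zero_of_chiSet_eq_empty 𝔠 h]

/-- [folklore] **A CORE CARRYING A KILL LETTER HAS ZERO TERM** (all `o`, `y`). -/
theorem termAt_eq_zero_of_mem_cons (𝔠 : BiCore P dom Op PΛ V) {b : V →L[ℝ] ℝ} {thr : ℝ} (hc : (b, thr, true) ∈ 𝔠.cons)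
    (hthr : thr ≤ 0) (o : Op) (y : B13HistM P) : 𝔠.termAt o y = 0 :=
  termAt_eq_zero_of_chiSet_eq_empty 𝔠 (chiSet_eq_empty_of_mem_cons 𝔠 hc hthr) o y

/-- [folklore] The empty-window form. -/
theorem termAt_eq_zero_of_zero_window_mem (𝔠 : BiCore P dom Op PΛ V) (hc : ((0 : V →L[ℝ] ℝ), (0 : ℝ), true) ∈ 𝔠.cons)
    (o : Op) (y : B13HistM P) : 𝔠.termAt o y = 0 :=
  termAt_eq_zero_of_mem_cons 𝔠 hc le_rfl o y

end Core

/-! ## §2 At the substrate's letters: `actOfLetters` and the `act` slot of record -/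

section Letters

variable {C : Carriers} (P : MeasPotFrame C) (Op : Type*) {Pol J : Type*}
  (𝒴 : Pol → J → Type) [∀ Z j, Fintype (𝒴 Z j)] (dom : ∀ Z j, 𝒴 Z j → C.Dom)
  (Jc : Pol → J → Type) [∀ Z j, Fintype (Jc Z j)]
  (V : Pol → J → Type) [∀ Z j, NormedAddCommGroup (V Z j)] [∀ Z j, InnerProductSpace ℝ (V Z j)]
  [∀ Z j, MeasurableSpace (V Z j)] [∀ Z j, BorelSpace (V Z j)] [∀ Z j, FiniteDimensional ℝ (V Z j)]

/-- [folklore] **THE ACTIVITY OF RECORD VANISHES AT A KILLED FACTOR**: `(b, thr, true) ∈ (ℓ Z j).cons`, `thr ≤ 0` ⇒ `actOfLetters … ℓ Z j o y = 0`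
for every operator datum `o` and table `y` (`actOfLetters_apply` + `coreOf_cons` + §1). -/
theorem actOfLetters_eq_zero_of_mem_cons (ℓ : ∀ Z j, CoreLetters P Op 𝒴 dom Jc V Z j) {Z : Pol} {j : J} {b : V Z j →L[ℝ] ℝ}
    {thr : ℝ} (hc : (b, thr, true) ∈ (ℓ Z j).cons) (hthr : thr ≤ 0) (o : Op) (y : B13HistM P) :
    actOfLetters P Op 𝒴 dom Jc V ℓ Z j o y = 0 := by
  rw [actOfLetters_apply]
  exact termAt_eq_zero_of_mem_cons (coreOf P Op 𝒴 dom Jc V ℓ Z j) (by rw [coreOf_cons]; exact hc) hthr o y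

end Letters

section SlotsRecord

variable {G : Type} [GaugeGroup G] (D : DrivenRuns G)
variable {o : Type} [Fintype o] [DecidableEq o] (ι : G →* Matrix o o ℂ) (c : ℂ) (a : ℝ) (s : ℕ → ℂ)
variable {T ι' S Ω 𝒴 : Type} (P : MeasPotFrame D.carriers) {IOp : Type*}
  (𝒵 : D.carriers.Dom → InnerLabel D.carriers.Dom (Bnd D.toTwoRuns) → Type) [∀ Z j, Fintype (𝒵 Z j)] (dom : ∀ Z j, 𝒵 Z j → D.carriers.Dom)
  (Jc : D.carriers.Dom → InnerLabel D.carriers.Dom (Bnd D.toTwoRuns) → Type) [∀ Z j, Fintype (Jc Z j)]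
  (V : D.carriers.Dom → InnerLabel D.carriers.Dom (Bnd D.toTwoRuns) → Type) [∀ Z j, NormedAddCommGroup (V Z j)]
  [∀ Z j, InnerProductSpace ℝ (V Z j)] [∀ Z j, MeasurableSpace (V Z j)] [∀ Z j, BorelSpace (V Z j)] [∀ Z j, FiniteDimensional ℝ (V Z j)]
  (mI : D.carriers.Dom → InnerLabel D.carriers.Dom (Bnd D.toTwoRuns) → Type) [∀ Z j, Fintype (mI Z j)] [∀ Z j, DecidableEq (mI Z j)]

omit [Fintype o] [DecidableEq o] [∀ Z j, Fintype (𝒵 Z j)] [∀ Z j, Fintype (Jc Z j)] [∀ Z j, BorelSpace (V Z j)]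
  [∀ Z j, FiniteDimensional ℝ (V Z j)] in
/-- [folklore] The χ-constraint letter of the core letters of record IS the displayed one (`rfl`). -/
theorem coreLettersOf_cons (A : ∀ Z j, ActLetters D P (OpDatum (SpeciesRec D o T ι' Ω 𝒴)) 𝒵 dom Jc V mI Z j)
    (Z : D.carriers.Dom) (j : InnerLabel D.carriers.Dom (Bnd D.toTwoRuns)) :
    (coreLettersOf D P (OpDatum (SpeciesRec D o T ι' Ω 𝒴)) 𝒵 dom Jc V mI A Z j).cons = (A Z j).cons := rfl

variable (L : SlotLetters D (o := o) (T := T) (ι' := ι') (S := S) (Ω := Ω) (𝒴 := 𝒴) P (IOp := IOp) 𝒵 dom Jc V mI)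

/-- [folklore] **THE `act` SLOT OF RECORD VANISHES AT A KILLED LABEL**: if the calibration table's χ-list at `(Z, ℓ)` contains a small-field
window `(b, thr, true)` with `thr ≤ 0`, then `(slotsOfRecord …).act Z ℓ od y = 0` for every operator datum and table (O-8 `slotsOfRecord_act` + §2). -/
theorem slotsOfRecord_act_eq_zero_of_mem_cons {Z : D.carriers.Dom} {ℓ : InnerLabel D.carriers.Dom (Bnd D.toTwoRuns)}
    {b : V Z ℓ →L[ℝ] ℝ} {thr : ℝ} (hc : (b, thr, true) ∈ (L.A Z ℓ).cons) (hthr : thr ≤ 0) (od : OpDatum (SpeciesRec D o T ι' Ω 𝒴))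
    (y : B13HistM P) : (slotsOfRecord D ι c a s P 𝒵 dom Jc V mI L).act Z ℓ od y = 0 := by
  rw [slotsOfRecord_act]
  exact actOfLetters_eq_zero_of_mem_cons P _ 𝒵 dom Jc V _ (by rw [coreLettersOf_cons]; exact hc) hthr od y

/-- [folklore] The empty-window form: `((0 : V Z ℓ →L[ℝ] ℝ), 0, true) ∈ (L.A Z ℓ).cons ⇒ (slotsOfRecord …).act Z ℓ od y = 0`. -/
theorem slotsOfRecord_act_eq_zero_of_zero_window_mem {Z : D.carriers.Dom} {ℓ : InnerLabel D.carriers.Dom (Bnd D.toTwoRuns)}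
    (hc : ((0 : V Z ℓ →L[ℝ] ℝ), (0 : ℝ), true) ∈ (L.A Z ℓ).cons) (od : OpDatum (SpeciesRec D o T ι' Ω 𝒴)) (y : B13HistM P) :
    (slotsOfRecord D ι c a s P 𝒵 dom Jc V mI L).act Z ℓ od y = 0 :=
  slotsOfRecord_act_eq_zero_of_mem_cons D ι c a s P 𝒵 dom Jc V mI L hc le_rfl od y

/-- [folklore] The same at the COV-SHIFTED slots of record (W-21: their `act` is `slotsOfRecord`'s, `rfl`). -/
theorem slotsOfRecordShift_act_eq_zero_of_mem_cons {Z : D.carriers.Dom} {ℓ : InnerLabel D.carriers.Dom (Bnd D.toTwoRuns)}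
    {b : V Z ℓ →L[ℝ] ℝ} {thr : ℝ} (hc : (b, thr, true) ∈ (L.A Z ℓ).cons) (hthr : thr ≤ 0) (od : OpDatum (SpeciesRec D o T ι' Ω 𝒴))
    (y : B13HistM P) : (slotsOfRecordShift D ι c a s P 𝒵 dom Jc V mI L).act Z ℓ od y = 0 := by
  rw [slotsOfRecordShift_act]
  exact slotsOfRecord_act_eq_zero_of_mem_cons D ι c a s P 𝒵 dom Jc V mI L hc hthr od y

/-- [folklore] **PRUNING A LABEL SUM TO THE CALIBRATION's FILTER** (the owner-side use of the kill letter, packaged): if every label of `S`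
OFF a decidable filter `fine` is KILLED by the calibration at `Z` (its χ-list contains a small-field window with non-positive threshold),
then the activity sum over `S` equals the sum over `S.filter fine` (`Finset.sum_filter_of_ne` + `slotsOfRecord_act_eq_zero_of_mem_cons`). -/
theorem sum_slotsOfRecord_act_eq_sum_filter {Z : D.carriers.Dom} (S : Finset (InnerLabel D.carriers.Dom (Bnd D.toTwoRuns)))
    (fine : InnerLabel D.carriers.Dom (Bnd D.toTwoRuns) → Prop) [DecidablePred fine]
    (hkill : ∀ ℓ ∈ S, ¬ fine ℓ → ∃ (b : V Z ℓ →L[ℝ] ℝ) (thr : ℝ), thr ≤ 0 ∧ (b, thr, true) ∈ (L.A Z ℓ).cons)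
    (od : OpDatum (SpeciesRec D o T ι' Ω 𝒴)) (y : B13HistM P) :
    ∑ ℓ ∈ S, (slotsOfRecord D ι c a s P 𝒵 dom Jc V mI L).act Z ℓ od y =
      ∑ ℓ ∈ S.filter fine, (slotsOfRecord D ι c a s P 𝒵 dom Jc V mI L).act Z ℓ od y := by
  rw [Finset.sum_filter_of_ne]
  intro ℓ hℓ hne
  by_contra hfine
  obtain ⟨b, thr, hthr, hc⟩ := hkill ℓ hℓ hfine
  exact hne (slotsOfRecord_act_eq_zero_of_mem_cons D ι c a s P 𝒵 dom Jc V mI L hc hthr od y)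

end SlotsRecord

/-! ## §3 Term level: one killed factor zeroes the (2.13)-term -/

section Term

variable {C : Carriers} {ιT Pl J Op Hist : Type*} (𝒯 : TermIndexing C ιT Pl J) (inc : Pl → Pl → Prop) [DecidableRel inc]
  (act : Pl → J → Op → Hist → ℂ)

/-- [folklore] **ONE VANISHING FACTOR ACTIVITY ZEROES THE TERM** (generic over leaf-08's `TermIndexing`): if the activity of the `m`-th factor
`act (poly i m) (lab i m) o y` is `0`, then `term 𝒯 inc act k i o y X = 0` (off the localization relation the term is `0` anyway; on it, it is
`coeff · Π_m act …` and the product has a zero factor). -/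
theorem term_eq_zero_of_factor_eq_zero {k : ℕ} {i : ιT} {X : C.Dom} {o : Op} {y : Hist} (m : Fin (𝒯.len i + 1))
    (hm : act (𝒯.poly i m) (𝒯.lab i m) o y = 0) : term 𝒯 inc act k i o y X = 0 := by
  by_cases hR : 𝒯.Rel k i X
  · rw [term_of_rel 𝒯 inc act hR, Finset.prod_eq_zero (Finset.mem_univ m) hm, mul_zero]
  · exact term_of_not_rel 𝒯 inc act hR o y

end Term

section TermRecord

variable {G : Type} [GaugeGroup G] (D : DrivenRuns G)
variable {o : Type} [Fintype o] [DecidableEq o] (ι : G →* Matrix o o ℂ) (c : ℂ) (a : ℝ) (s : ℕ → ℂ)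
variable {T ι' S Ω 𝒴 : Type} (P : MeasPotFrame D.carriers) {IOp : Type*}
  (𝒵 : D.carriers.Dom → InnerLabel D.carriers.Dom (Bnd D.toTwoRuns) → Type) [∀ Z j, Fintype (𝒵 Z j)] (dom : ∀ Z j, 𝒵 Z j → D.carriers.Dom)
  (Jc : D.carriers.Dom → InnerLabel D.carriers.Dom (Bnd D.toTwoRuns) → Type) [∀ Z j, Fintype (Jc Z j)]
  (V : D.carriers.Dom → InnerLabel D.carriers.Dom (Bnd D.toTwoRuns) → Type) [∀ Z j, NormedAddCommGroup (V Z j)]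
  [∀ Z j, InnerProductSpace ℝ (V Z j)] [∀ Z j, MeasurableSpace (V Z j)] [∀ Z j, BorelSpace (V Z j)] [∀ Z j, FiniteDimensional ℝ (V Z j)]
  (mI : D.carriers.Dom → InnerLabel D.carriers.Dom (Bnd D.toTwoRuns) → Type) [∀ Z j, Fintype (mI Z j)] [∀ Z j, DecidableEq (mI Z j)]
  (L : SlotLetters D (o := o) (T := T) (ι' := ι') (S := S) (Ω := Ω) (𝒴 := 𝒴) P (IOp := IOp) 𝒵 dom Jc V mI)

/-- [folklore] **A TERM OF THE STEP OF RECORD WITH A KILLED FACTOR LABEL IS ZERO**: for the slots of record on the two-run object, a term label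
`t : TermIdx` one of whose factors `t.2 m = (Z_m; ℓ_m)` carries a kill letter in the calibration's χ-list at `(Z_m, ℓ_m)` contributes `0` to the
output of record `(step (slotsOfRecord …) E₀ cB).Out k od y X` (`B13StepOfRecord.step_Out`: the output IS leaf-08's `out` of these terms). -/
theorem term_slotsOfRecord_eq_zero_of_mem_cons {k : ℕ} {t : TermIdx D.carriers.Dom (Bnd D.toTwoRuns)} {X : D.carriers.Dom}
    {od : OpDatum (SpeciesRec D o T ι' Ω 𝒴)} {y : B13HistM P} (m : Fin (t.1 + 1)) {b : V (t.2 m).Z (t.2 m).inner →L[ℝ] ℝ} {thr : ℝ}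
    (hc : (b, thr, true) ∈ (L.A (t.2 m).Z (t.2 m).inner).cons) (hthr : thr ≤ 0) :
    term (labelsIndexing (B13DomainGeometryTR.domainGeometry D.toTwoRuns) (b13InnerData D.toTwoRuns))
      (touchInc (B13DomainGeometryTR.domainGeometry D.toTwoRuns)) (slotsOfRecord D ι c a s P 𝒵 dom Jc V mI L).act k t od y X = 0 :=
  term_eq_zero_of_factor_eq_zero _ _ _ m (slotsOfRecord_act_eq_zero_of_mem_cons D ι c a s P 𝒵 dom Jc V mI L hc hthr od y)

end TermRecord

end Summit.QuantumFields.BalabanUV.T4Continuum.SubstrateSlotActZero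

end
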